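import Literature.RingTheory.Henselian.FiniteFlatHopfAlgebraRankPointCount
import Literature.AlgebraicGeometry.GroupSchemes.UnitComponentOfFiniteGroupScheme
import Literature.AlgebraicGeometry.GroupSchemes.ConnectedFactorsThroughUnitComponent
import Literature.AlgebraicGeometry.Morphisms.FiniteBaseChangeAffine
import Mathlib.AlgebraicGeometry.Morphisms.Flat
import HarnessLib

/-!
# `rank G = #G(k) · rank G⁰` for a finite flat group scheme over a henselian local ring and its unit component
# ([Tate1997FiniteFlatGroupSchemes] (3.7); [MumfordAV1970] §12)

Topic `Literature/AlgebraicGeometry/GroupSchemes`; namespace `Literature.AlgebraicGeometry.GroupSchemes`.  THEOREMS ONLY (no definition, no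
named fact, no instance, no notation, no `sorry`).  Cell `hodgecm-mathlib`, P6 «MOD programme», desk F0P6b-plan (g0) sub-line
`Cruxes/HLiu418/Lines/F0_P6b_ConnectedEtale.lean`, letters (b1c) `stub_b1c_rankEqCardMulRank` ∕ (b1cg) `stub_b1cg_rankEqCardMulRank_geom`
— SCHEME WRAPPER of the algebra count ★ `Henselian.finrank_eq_natCard_algHom_mul_finrank_unitCorner` (strategy σ2).  For a finite flat group
scheme `G` over a henselian local ring `R` (a group object of `Over (Spec R)`), a unit component `j : G₀ ↪ G` (homomorphic open-and-closed
immersion with connected source — the line's `IsUnitComponent G G₀ j`, UNFOLDED), coordinate rings `G = Spec B`, `G₀ = Spec B₀` over `R`, and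
an algebraically closed field `k` under the residue field `κ(R)`: **`rank_R B = #G(k) · rank_R B₀`**, `G(k)` the `k`-points of `G` over
`Spec R`.

* §1 `nonempty_algEquiv_of_specIso` — an isomorphism `Spec A ≅ Spec B` over `Spec R` is an `R`-algebra isomorphism `B ≃ₐ[R] A`;
  `nonempty_algEquiv_alg_of_presentation` — a presentation `G.left ≅ Spec B` over `R` identifies `B` with ★ `AffineGroupScheme.Alg G = Γ(G, 𝒪_G)`.
* §2 `specPointsEquivAlgHom` (as a theorem `nonempty_specPoints_equiv_algHom` + `natCard_specPoints_eq`) — `k`-points `Spec k → G` over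
  `Spec R` are the `R`-algebra maps `Γ(G, 𝒪_G) → k` (★ `AffineGroupScheme.ptEquiv`).
* §3 `nonempty_algEquiv_unitCorner_of_isUnitComponent` — ANY unit component is `Spec` of the unit corner `Γ(G, 𝒪_G) ⧸ (1 - e)` of the unit
  idempotent (★ `exists_grpObj_isMonHom_quotIncl_unitIdempotent`): two unit components factor through each other (★ `existsUnique_fac_hom`).
* §4 **`finrank_eq_natCard_points_mul_finrank_geom`** = the text of `stub_b1cg_rankEqCardMulRank_geom`, and **`finrank_eq_natCard_points_mul_finrank`**
  = the text of `stub_b1c_rankEqCardMulRank` (`k = κ(R)`).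

HC_CM is proved only modulo the printed citations until rung 0 closes; generic algebraic geometry, no count changes.

## References
* [Tate1997FiniteFlatGroupSchemes] J. Tate, *Finite flat group schemes*, in: Cornell–Silverman–Stevens (eds.), *Modular Forms and Fermat's
  Last Theorem* (Springer 1997), (3.7) («`rank G = #G(k̄) · rank G⁰`»; `G⁰` the connected component of the identity).
* [MumfordAV1970] D. Mumford, *Abelian Varieties* (1970), §12.
* [GortzWedhorn2023] U. Görtz, T. Wedhorn, *Algebraic Geometry II* (2023), §(27.2) (affine group schemes and Hopf algebras).
-/

set_option autoImplicit false

noncomputable section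

universe u

open CategoryTheory CategoryTheory.Limits AlgebraicGeometry MonoidalCategory CartesianMonoidalCategory IsLocalRing
open scoped MonObj

namespace Literature.AlgebraicGeometry.GroupSchemes

open Literature.AlgebraicGeometry.Motives (SchemeOver specOver)

/-! ## §1 Spec-isomorphisms over `R` are `R`-algebra isomorphisms -/

section SpecIso

variable {R : Type u} [CommRing R]

/-- **An isomorphism `ε : Spec A ≅ Spec B` commuting with the structure maps to `Spec R` is an `R`-algebra isomorphism `B ≃ₐ[R] A`**
(`Spec` is fully faithful). [cite: GortzWedhorn2023, §(27.2) (p. 606)] -/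
theorem nonempty_algEquiv_of_specIso (A B : Type u) [CommRing A] [CommRing B] [Algebra R A] [Algebra R B]
    (ε : Spec (.of A) ≅ Spec (.of B))
    (hε : ε.hom ≫ Spec.map (CommRingCat.ofHom (algebraMap R B)) = Spec.map (CommRingCat.ofHom (algebraMap R A))) :
    Nonempty (B ≃ₐ[R] A) := by
  let g : CommRingCat.of B ⟶ CommRingCat.of A := Spec.preimage ε.hom
  let g' : CommRingCat.of A ⟶ CommRingCat.of B := Spec.preimage ε.inv
  have hgg' : g ≫ g' = 𝟙 _ := Spec.map_injective (by
    rw [Spec.map_comp, Spec.map_preimage, Spec.map_preimage, Iso.inv_hom_id, Spec.map_id])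
  have hg'g : g' ≫ g = 𝟙 _ := Spec.map_injective (by
    rw [Spec.map_comp, Spec.map_preimage, Spec.map_preimage, Iso.hom_inv_id, Spec.map_id])
  have hcomm : CommRingCat.ofHom (algebraMap R B) ≫ g = CommRingCat.ofHom (algebraMap R A) := Spec.map_injective (by
    rw [Spec.map_comp, Spec.map_preimage, hε])
  let e : B ≃+* A :=
    { toFun := g.hom
      invFun := g'.hom
      left_inv := fun b => by
        change (g ≫ g').hom b = b
        rw [hgg']; rfl
      right_inv := fun a => by
        change (g' ≫ g).hom a = a
        rw [hg'g]; rfl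
      map_mul' := map_mul g.hom
      map_add' := map_add g.hom }
  refine ⟨AlgEquiv.ofRingEquiv (f := e) fun r => ?_⟩
  change (CommRingCat.ofHom (algebraMap R B) ≫ g).hom r = algebraMap R A r
  rw [hcomm]; rfl

/-- **A presentation `eB : G ≅ Spec B` over `R` identifies `B` with `Γ(G, 𝒪_G)`** (★ `AffineGroupScheme.Alg G`, whose `R`-algebra structure
is `R ≅ Γ(Spec R) → Γ(G)`): `B ≃ₐ[R] Alg G`. [cite: GortzWedhorn2023, §(27.2) (p. 606)] -/
theorem nonempty_algEquiv_alg_of_presentation (G : SchemeOver R) [IsAffine G.left] (B : Type u) [CommRing B] [Algebra R B]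
    (eB : G.left ≅ Spec (.of B)) (heB : eB.hom ≫ Spec.map (CommRingCat.ofHom (algebraMap R B)) = G.hom) :
    Nonempty (B ≃ₐ[R] AffineGroupScheme.Alg G) := by
  refine nonempty_algEquiv_of_specIso (R := R) (AffineGroupScheme.Alg G) B (G.left.isoSpec.symm ≪≫ eB) ?_
  rw [Iso.trans_hom, Iso.symm_hom, Category.assoc, heB]
  exact Literature.AlgebraicGeometry.Morphisms.isoSpec_inv_comp_eq G.hom

end SpecIso

/-! ## §2 `k`-points `Spec k → G` over `Spec R` are the `R`-algebra maps `Γ(G, 𝒪_G) → k` -/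

section Points

variable {R : Type u} [CommRing R] (G : SchemeOver R) [IsAffine G.left] (k : Type u) [CommRing k] [Algebra R k]

/-- The points `t : Spec k ⟶ G` with prescribed composite `t ≫ (G → Spec R) = Spec (R → k)` ARE the morphisms `specOver R k ⟶ G` over
`Spec R`, hence (★ `AffineGroupScheme.ptEquiv`) the `R`-algebra maps `Γ(G, 𝒪_G) → k`: the two sets have the same cardinality.
[cite: GortzWedhorn2023, §(27.2) (p. 606)] -/
theorem natCard_specPoints_eq_natCard_algHom :
    Nat.card {t : Spec (.of k) ⟶ G.left // t ≫ G.hom = Spec.map (CommRingCat.ofHom (algebraMap R k))} =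
      Nat.card (AffineGroupScheme.Alg G →ₐ[R] k) := by
  refine Nat.card_congr (Equiv.trans ?_ (AffineGroupScheme.ptEquiv G k))
  exact
    { toFun := fun t => Over.homMk t.1 t.2
      invFun := fun u => ⟨u.left, Over.w u⟩
      left_inv := fun _ => rfl
      right_inv := fun _ => rfl }

end Points

/-! ## §3 Any unit component is `Spec` of the unit corner -/

section UnitComponent

variable (R : Type u) [CommRing R] [HenselianLocalRing R] (G : SchemeOver R) [GrpObj G] [IsFinite G.hom]

/-- **UNIQUENESS OF THE UNIT COMPONENT, IN COORDINATES.**  Let `j : G₀ ⟶ G` be a unit component of the finite group scheme `G` over the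
henselian local ring `R` (a homomorphism whose underlying morphism is an open and closed immersion with connected source), presented as
`eB₀ : G₀ ≅ Spec B₀` over `R`.  Then for the unit idempotent `e ∈ Γ(G, 𝒪_G)` of ★ `exists_grpObj_isMonHom_quotIncl_unitIdempotent`
(`e ≡ 1 (mod 𝔫_ε)`, `e` in every other maximal ideal) **`B₀ ≃ₐ[R] Γ(G, 𝒪_G) ⧸ (1 - e)`**: the two unit components `G₀` and
`Spec (Γ(G) ⧸ (1 - e))` factor through each other (★ `existsUnique_fac_hom`), the factorisations being mutually inverse because both
inclusions are monomorphisms. [cite: Tate1997FiniteFlatGroupSchemes, (3.7) (I) (p. 141)] -/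
theorem exists_unitIdempotent_algEquiv_of_isUnitComponent (G₀ : SchemeOver R) [GrpObj G₀] (j : G₀ ⟶ G) [IsMonHom j]
    [IsOpenImmersion j.left] [IsClosedImmersion j.left] [ConnectedSpace G₀.left]
    (B₀ : Type u) [CommRing B₀] [Algebra R B₀] (eB₀ : G₀.left ≅ Spec (.of B₀))
    (heB₀ : eB₀.hom ≫ Spec.map (CommRingCat.ofHom (algebraMap R B₀)) = G₀.hom) :
    haveI : IsAffine G.left := AffineGroupScheme.isAffine_left_of_isAffineHom G
    ∃ e : AffineGroupScheme.Alg G, IsIdempotentElem e ∧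
      e - 1 ∈ RingHom.ker ((residue R).comp (Bialgebra.counitAlgHom R (AffineGroupScheme.Alg G) : _ →+* R)) ∧
      (∀ 𝔫 : Ideal (AffineGroupScheme.Alg G), 𝔫.IsMaximal →
        𝔫 ≠ RingHom.ker ((residue R).comp (Bialgebra.counitAlgHom R (AffineGroupScheme.Alg G) : _ →+* R)) → e ∈ 𝔫) ∧
      Nonempty (B₀ ≃ₐ[R] (AffineGroupScheme.Alg G ⧸ Ideal.span {1 - e})) := by
  haveI : IsAffine G.left := AffineGroupScheme.isAffine_left_of_isAffineHom G
  -- the explicit unit component `G₁ = Spec (Alg G ⧸ (1 - e))` with its inclusion `j₁ = quotIncl` (instances land in the context)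
  obtain ⟨e, he, he1, he0, hI, -, GZ, hj₁, ho₁, hc₁, hconn₁⟩ := exists_grpObj_isMonHom_quotIncl_unitIdempotent R G
  refine ⟨e, he, he1, he0, ?_⟩
  have hmj : Mono j := Over.mono_of_mono_left _
  have hmj₁ : Mono (AffineGroupScheme.quotIncl G (Ideal.span {1 - e})) := Over.mono_of_mono_left _
  have hne : Nonempty (𝟙_ (SchemeOver R)).left := ⟨(IsLocalRing.closedPoint R : PrimeSpectrum R)⟩
  -- mutual factorisations of the two unit components through each other
  obtain ⟨a, ha, -⟩ := existsUnique_fac_hom (AffineGroupScheme.quotIncl G (Ideal.span {1 - e})) j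
  obtain ⟨b, hb, -⟩ := existsUnique_fac_hom j (AffineGroupScheme.quotIncl G (Ideal.span {1 - e}))
  have hab : a ≫ b = 𝟙 _ := by rw [← cancel_mono j, Category.assoc, hb, ha, Category.id_comp]
  have hba : b ≫ a = 𝟙 _ := by
    rw [← cancel_mono (AffineGroupScheme.quotIncl G (Ideal.span {1 - e})), Category.assoc, ha, hb, Category.id_comp]
  let ee : G₀ ≅ specOver R (AffineGroupScheme.Alg G ⧸ Ideal.span {1 - e}) :=
    { hom := a, inv := b, hom_inv_id := hab, inv_hom_id := hba }
  -- `Spec (Alg G ⧸ I) ≅ G₀.left ≅ Spec B₀` over `Spec R`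
  refine nonempty_algEquiv_of_specIso (R := R) (AffineGroupScheme.Alg G ⧸ Ideal.span {1 - e}) B₀
    (((Over.forget _).mapIso ee).symm ≪≫ eB₀) ?_
  change ee.inv.left ≫ eB₀.hom ≫ Spec.map (CommRingCat.ofHom (algebraMap R B₀)) =
    Spec.map (CommRingCat.ofHom (algebraMap R (AffineGroupScheme.Alg G ⧸ Ideal.span {1 - e})))
  rw [heB₀]
  exact Over.w ee.inv

end UnitComponent

/-! ## §4 The count `rank G = #G(k) · rank G⁰` — texts of `stub_b1cg_rankEqCardMulRank_geom` and `stub_b1c_rankEqCardMulRank` -/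

section Count

/-- **`rank_R Γ(G) = #G(k) · rank_R Γ(G⁰)` ([Tate1997FiniteFlatGroupSchemes] (3.7)), GEOMETRIC POINTS.**  Over a henselian local ring `R`,
for a finite flat group scheme `G = Spec B` (a group object of `Over (Spec R)` with `G → Spec R` finite and flat) with a unit component
`j : G₀ = Spec B₀ ↪ G` (homomorphic open-and-closed immersion with connected source) and ANY algebraically closed field `k` over `κ(R)` via
`φ : κ(R) → k`: **`finrank R B = #{t : Spec k → G over Spec R} · finrank R B₀`**.  Proof: `B ≃ₐ[R] Γ(G)` is a commutative Hopf algebra,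
module-finite and free (finite flat over a local ring); `k`-points are `R`-algebra maps `Γ(G) → k` (§2); `B₀ ≃ₐ[R] Γ(G) ⧸ (1 - e)` for the unit
idempotent (§3); conclude by ★ `Henselian.finrank_eq_natCard_algHom_mul_finrank_unitCorner`.  This is the text of the cell's stub
`stub_b1cg_rankEqCardMulRank_geom` (line `F0_P6b_ConnectedEtale` ED. 2), `IsUnitComponent` unfolded.
[cite: Tate1997FiniteFlatGroupSchemes, (3.7) (p. 141)] [cite: MumfordAV1970, §12] -/
theorem finrank_eq_natCard_points_mul_finrank_geom :
    ∀ (R : Type) [CommRing R] [HenselianLocalRing R] (k : Type) [Field k] [IsAlgClosed k] (φ : ResidueField R →+* k)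
      (G G₀ : Over (Spec (.of R))) [GrpObj G] [GrpObj G₀] (j : G₀ ⟶ G),
      IsFinite G.hom → Flat G.hom → (IsMonHom j ∧ IsOpenImmersion j.left ∧ IsClosedImmersion j.left ∧ ConnectedSpace G₀.left) →
        ∀ (B : Type) [CommRing B] [Algebra R B] (eB : G.left ≅ Spec (.of B)),
          eB.hom ≫ Spec.map (CommRingCat.ofHom (algebraMap R B)) = G.hom →
        ∀ (B₀ : Type) [CommRing B₀] [Algebra R B₀] (eB₀ : G₀.left ≅ Spec (.of B₀)),
          eB₀.hom ≫ Spec.map (CommRingCat.ofHom (algebraMap R B₀)) = G₀.hom →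
            Module.finrank R B =
              Nat.card {t : Spec (.of k) ⟶ G.left //
                  t ≫ G.hom = Spec.map (CommRingCat.ofHom (φ.comp (residue R)))} * Module.finrank R B₀ := by
  intro R _ _ k _ _ φ G G₀ _ _ j hGf hGfl hj B _ _ eB heB B₀ _ _ eB₀ heB₀
  obtain ⟨hmon, hopen, hclosed, hconn⟩ := hj
  haveI := hGf
  haveI := hGfl
  haveI := hmon
  haveI := hopen
  haveI := hclosed
  haveI := hconn
  haveI : IsAffine G.left := AffineGroupScheme.isAffine_left_of_isAffineHom G
  letI : Algebra R k := (φ.comp (residue R)).toAlgebra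
  have hk : maximalIdeal R ≤ RingHom.ker (algebraMap R k) := fun x hx => by
    rw [RingHom.mem_ker, RingHom.algebraMap_toAlgebra, RingHom.comp_apply, (IsLocalRing.residue_eq_zero_iff x).mpr hx, map_zero]
  -- `Γ(G)` is a finite free commutative Hopf `R`-algebra
  haveI : Module.Finite R (AffineGroupScheme.Alg G) := AffineGroupScheme.Alg.moduleFinite G
  haveI : Module.Free R (AffineGroupScheme.Alg G) := Literature.AlgebraicGeometry.Morphisms.moduleFree_sections G.hom
  -- identify `B`, `B₀` and the points
  obtain ⟨θ⟩ := nonempty_algEquiv_alg_of_presentation (R := R) G B eB heB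
  obtain ⟨e, he, he1, he0, ⟨θ₀⟩⟩ := exists_unitIdempotent_algEquiv_of_isUnitComponent R G G₀ j B₀ eB₀ heB₀
  have hpts := natCard_specPoints_eq_natCard_algHom (R := R) G k
  rw [RingHom.algebraMap_toAlgebra] at hpts
  rw [hpts, θ.toLinearEquiv.finrank_eq, θ₀.toLinearEquiv.finrank_eq]
  exact Literature.RingTheory.Henselian.finrank_eq_natCard_algHom_mul_finrank_unitCorner (R := R) (B := AffineGroupScheme.Alg G)
    k hk he he1 he0

/-- **`rank_R Γ(G) = #G(κ(R)) · rank_R Γ(G⁰)` over an ALGEBRAICALLY CLOSED residue field** — the case `k = κ(R)`, `φ = id` of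
`finrank_eq_natCard_points_mul_finrank_geom`; the text of the cell's stub `stub_b1c_rankEqCardMulRank` (line `F0_P6b_ConnectedEtale` ED. 1),
`IsUnitComponent` unfolded. [cite: Tate1997FiniteFlatGroupSchemes, (3.7) (p. 141)] [cite: MumfordAV1970, §12] -/
theorem finrank_eq_natCard_points_mul_finrank :
    ∀ (R : Type) [CommRing R] [HenselianLocalRing R] [IsAlgClosed (ResidueField R)]
      (G G₀ : Over (Spec (.of R))) [GrpObj G] [GrpObj G₀] (j : G₀ ⟶ G),
      IsFinite G.hom → Flat G.hom → (IsMonHom j ∧ IsOpenImmersion j.left ∧ IsClosedImmersion j.left ∧ ConnectedSpace G₀.left) →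
        ∀ (B : Type) [CommRing B] [Algebra R B] (eB : G.left ≅ Spec (.of B)),
          eB.hom ≫ Spec.map (CommRingCat.ofHom (algebraMap R B)) = G.hom →
        ∀ (B₀ : Type) [CommRing B₀] [Algebra R B₀] (eB₀ : G₀.left ≅ Spec (.of B₀)),
          eB₀.hom ≫ Spec.map (CommRingCat.ofHom (algebraMap R B₀)) = G₀.hom →
            Module.finrank R B =
              Nat.card {t : Spec (.of (ResidueField R)) ⟶ G.left //
                  t ≫ G.hom = Spec.map (CommRingCat.ofHom (residue R))} * Module.finrank R B₀ := by
  intro R _ _ _ G G₀ _ _ j hGf hGfl hj B _ _ eB heB B₀ _ _ eB₀ heB₀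
  have h := finrank_eq_natCard_points_mul_finrank_geom R (ResidueField R) (RingHom.id _) G G₀ j hGf hGfl hj B eB heB B₀ eB₀ heB₀
  rwa [RingHom.id_comp] at h

end Count

end Literature.AlgebraicGeometry.GroupSchemes

end
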